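import Summits.BirchSwinnertonDyer.Rank1Residual.AdditivePotMult.QuadraticTwistRamifiedMultiplicative
import Literature.NumberTheory.EllipticCurves.QuadraticTwistJInvariantProofs
import Literature.NumberTheory.DiophantineGeometry.MinimalDiscriminantSmulProofs
import Literature.NumberTheory.DiophantineGeometry.LocalReductionProofs
import HarnessLib

/-!
# The ramified prime of the X3♯(M)/X4(M) descent: `W` additive potentially multiplicative at
# `ℓ ∥ d`, `Wd = Cd • W^{(d)}` multiplicative — `ord Δ_min(W) = n + 6`, `ord_ℓ(Cd.u) = 1`, `c_ℓ(W) ≤ 4`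
# (row T-MIL-ODD, FILE A-4M; seat n1011-p01 GEN 5)

HONEST FRAMING (cell `b2b-bsdres`, run/shared/lean/b2b/bsd-rank1-residual/, verbatim in every
file): the goal of the cell is to DELETE the COMBINATION-SHAPED residual classes of the
Birch–Swinnerton-Dyer formula for ALL analytic-rank `≤ 1` elliptic curves over `ℚ` — "full BSD
formula for every rank `≤ 1` curve in class `C`" assembled STRICTLY from published theorems — so
that the rank-`≤ 1` remainder becomes exactly the CONSTRUCTION-SHAPED classes, which are TYPED
(missing-input `Prop`s), NOT attempted. This is not "finishing BSD". Sub-classes X3♯(M) / X4(M)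
(additive, potentially multiplicative prime; base-change-and-descend): a RESEARCH ROUTE; they stay
CONSTRUCTION-SHAPED; nothing is booked by this file; no mark / label moved. THEOREMS ONLY: no
definition, no named fact, no `sorry`.

## What and why (row T-MIL-ODD, `cells/n1011/skel/T-MIL-ODD.md`, §1 (A≥5)/(D) at the ramified prime)

In the X3♯(M)/X4(M) descent (`AdditivePotMult/Descent.lean`) the curve `W` is ADDITIVE,
POTENTIALLY MULTIPLICATIVE at `p`, `K = ℚ(√d)` is ramified at `p ∥ d`, and the globally minimal
twist `Wd = Cd • W^{(d)}` is MULTIPLICATIVE at `p` (additive-p1's `PotMult.mult_quadraticTwist_pStar`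
/ `exists_mult_pStar_twist_model`). The odd-`p` local identity (L_p)@p of Milne's quadratic
BSD-quotient identity there reads
`f·ord_𝔭(C'.u) + v_p(c_𝔭(W')) = ord_p(Cd.u) + v_p(c_p(W)) + v_p(c_p(Wd))`, and this file supplies
its `ℚ`-side entries, from the landed FILE A-2b applied to `V := Wd` (whose twist by `d` is
`ℚ`-isomorphic to `W`):

* `exists_variableChange_smul_eq_quadraticTwist_of_smul_quadraticTwist_eq` — `Cd • W^{(d)} = Wd`
  gives `W = C • Wd^{(d)}` for an explicit `C` (twisting twice is twisting by `d²`);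
* `hasAdditiveReductionAt_and_ordMinimalDiscriminant_of_mult_twist` — **`W` is additive at `v`
  with `ord_v Δ_min(W) = ord_v Δ_min(Wd) + 6`** (model independence
  `ordMinimalDiscriminant_smul_holds`, `hasAdditiveReductionAt_smul_iff_holds`);
* `valuation_u_eq_exp_neg_one_of_mult_twist` — **`ord_v(Cd.u) = 1`**: `Δ(Wd) = Cd.u⁻¹² d⁶ Δ(W)`
  with `ord_v Δ(W) = n + 6` (`W` globally minimal), `ord_v Δ(Wd) = n`, `ord_v d = 1`;
* `localTamagawaNumber_le_four_of_hasAdditiveReductionAt` (any `W/ℚ`, any additive place) and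
  `padicValNat_localTamagawaNumber_eq_zero_of_hasAdditiveReductionAt_of_five_le` — `c_v(W) ≤ 4`,
  so `v_p(c_v(W)) = 0` for `p ≥ 5` (Kodaira–Néron bound, tree `index_goodReductionSubgroup_le_four_holds`).

The `K`-side entries (`c_𝔭(W') = c_𝔭(Wd ⊗ K) = e·n` or `∈ {1,2}`, `ord_𝔭(C'.u) = 1` at the
ramified `𝔭`) follow from FILE A-1b applied to `Wd` and `W ⊗ K ≅ Wd ⊗ K` — next file.
HONEST LIMITS: TOOL theorems; the `p = 3` refinement `c_3(W) ∈ {2,4}` (type `I_n^*`) is NOT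
proved (stage B); closes no class, discharges no fact by itself; nothing about any curve asserted.
References: Silverman *AEC* VII.1 Prop. 1.3, VII.5 Prop. 5.1, X.5 Cor. 5.4; *ATAEC* Cor. IV.9.2 (d);
Kramer 1981 §2.
-/

noncomputable section

open scoped Classical NumberField

open WeierstrassCurve NumberField IsDedekindDomain Rat.HeightOneSpectrum
  Literature.NumberTheory.EllipticCurves Literature.NumberTheory.EllipticCurves.Rank1Residual
  Literature.NumberTheory.GaloisRepresentations Field IsLocalRing
  Summit.BirchSwinnertonDyer.Rank1Residual.Additive

namespace Summit.BirchSwinnertonDyer.Rank1Residual.AdditivePotMult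

/-! ## §1 Additive places: `c_v ≤ 4` -/

section Additive

variable (W : WeierstrassCurve ℚ) [W.IsElliptic] (v : HeightOneSpectrum (𝓞 ℚ))

/-- **`c_v(W) ≤ 4` at every place of additive reduction of `W/ℚ`** (Kodaira–Néron: the component
group of an additive fibre has at most `4` rational points; tree
`index_goodReductionSubgroup_le_four_holds` at the chosen local minimal model, which is not split
multiplicative). [cite: SilvermanATAEC1994, Cor. IV.9.2(d) (PDF p. 340)] -/
theorem localTamagawaNumber_le_four_of_hasAdditiveReductionAt (hadd : W.HasAdditiveReductionAt v) :
    ((W.baseChange (v.adicCompletion ℚ)).localTamagawaNumber (v.adicCompletionIntegers ℚ)) ≤ 4 := by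
  haveI : Finite (ResidueField (v.adicCompletionIntegers ℚ)) := Nat.finite_of_card_ne_zero
    (by rw [WeierstrassCurve.natCard_residueField_adicCompletionIntegers v]; exact (primesEquiv v).2.ne_zero)
  haveI : PerfectField (ResidueField (v.adicCompletionIntegers ℚ)) := PerfectField.ofFinite
  haveI : (W.localMinimalModel v).IsElliptic := W.isElliptic_localMinimalModel v
  have hns : ¬ (W.localMinimalModel v).HasSplitMultiplicativeReduction (v.adicCompletionIntegers ℚ) :=
    fun h => (hadd.not_hasMultiplicativeReductionAt) h.toHasMultiplicativeReduction
  exact ((W.localMinimalModel v).index_goodReductionSubgroup_le_four_holds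
    (v.adicCompletionIntegers ℚ) hns).2

/-- **`v_p(c_v(W)) = 0` for `p ≥ 5` at an additive place** (`c_v ≤ 4 < p`).
[cite: SilvermanATAEC1994, Cor. IV.9.2(d) (PDF p. 340)] -/
theorem padicValNat_localTamagawaNumber_eq_zero_of_hasAdditiveReductionAt_of_five_le
    (hadd : W.HasAdditiveReductionAt v) (p : ℕ) [Fact p.Prime] (h5 : 5 ≤ p) :
    padicValNat p ((W.baseChange (v.adicCompletion ℚ)).localTamagawaNumber
        (v.adicCompletionIntegers ℚ)) = 0 := by
  have hle := localTamagawaNumber_le_four_of_hasAdditiveReductionAt W v hadd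
  refine padicValNat.eq_zero_of_not_dvd fun hdvd => ?_
  haveI : (W.baseChange (v.adicCompletion ℚ)).IsElliptic := by rw [baseChange]; infer_instance
  have hpos : 0 < (W.baseChange (v.adicCompletion ℚ)).localTamagawaNumber
      (v.adicCompletionIntegers ℚ) :=
    Nat.pos_of_ne_zero (localTamagawaNumber_ne_zero_holds (v.adicCompletionIntegers ℚ) _)
  have := Nat.le_of_dvd hpos hdvd
  omega

end Additive

/-! ## §2 Twisting back: `Cd • W^{(d)} = Wd` gives `W ≅ Wd^{(d)}` over `ℚ` -/

section TwistBack

variable (W Wd : WeierstrassCurve ℚ)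

/-- **Twisting twice.** If `Cd • W^{(d)} = Wd` (`d ≠ 0`) then `W = C • Wd^{(d)}` for some change of
variables `C` over `ℚ`: `Wd^{(d)} = (u, d r, 0, 0) • W^{(d·d)}` (`quadraticTwist_smul`,
`quadraticTwist_quadraticTwist`) and `W^{(d²)} ≅ W^{(1)} ≅ W`
(`exists_variableChange_quadraticTwist_mul_sq`, `exists_variableChange_quadraticTwist_one`).
Silverman *AEC* X.5 Cor. 5.4 (iii). [cite: SilvermanAEC2009, X.5 Cor. 5.4] -/
theorem exists_variableChange_smul_eq_of_smul_quadraticTwist_eq {d : ℚ} (hd : d ≠ 0)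
    {Cd : VariableChange ℚ} (hCd : Cd • W.quadraticTwist d = Wd) :
    ∃ C : VariableChange ℚ, W = C • Wd.quadraticTwist d := by
  -- `Wd^{(d)} = D • W^{(d d)}`
  have h1 : Wd.quadraticTwist d =
      (⟨Cd.u, d * Cd.r, 0, 0⟩ : VariableChange ℚ) • W.quadraticTwist (d * d) := by
    rw [← hCd, quadraticTwist_smul, quadraticTwist_quadraticTwist]
  -- `W^{(d²)} = C₁ • W^{(1)}` and `W^{(1)} = C₂ • W`
  obtain ⟨C₁, hC₁⟩ := W.exists_variableChange_quadraticTwist_mul_sq 1 d hd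
  obtain ⟨C₂, hC₂⟩ := W.exists_variableChange_quadraticTwist_one
  refine ⟨((⟨Cd.u, d * Cd.r, 0, 0⟩ : VariableChange ℚ) * C₁ * C₂)⁻¹, ?_⟩
  rw [h1, show d * d = 1 * d ^ 2 by ring, ← hC₁, ← hC₂, smul_smul, smul_smul, smul_smul]
  have hone : ((⟨Cd.u, d * Cd.r, 0, 0⟩ : VariableChange ℚ) * C₁ * C₂)⁻¹ *
      (⟨Cd.u, d * Cd.r, 0, 0⟩ : VariableChange ℚ) * C₁ * C₂ = 1 := by group
  rw [hone, one_smul]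

end TwistBack

/-! ## §3 The ramified prime when the twist is multiplicative: `ord Δ_min(W) = n + 6`, `ord(Cd.u) = 1` -/

section PotMult

variable (W Wd : WeierstrassCurve ℚ) [W.IsElliptic] [W.IsGloballyMinimal] [Wd.IsElliptic]
  [Wd.IsGloballyMinimal] (v : HeightOneSpectrum (𝓞 ℚ))

omit [W.IsElliptic] [W.IsGloballyMinimal] in
/-- **`W` additive with `ord_v Δ_min(W) = ord_v Δ_min(Wd) + 6` when the ramified twist `Wd` is
multiplicative.** For `W`, `Wd` globally minimal over `ℚ`, `Cd • W^{(d)} = Wd`, `v` over an odd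
prime `ℓ` with `ℓ ∥ d`, and `Wd` MULTIPLICATIVE at `v` (the X3♯(M)/X4(M) situation at `ℓ = p`,
`d = p*`): `W ≅ Wd^{(d)}` is the ramified twist of a multiplicative curve, so (FILE A-2b,
`hasAdditiveReductionAt_quadraticTwist_of_dvd_of_mult`, transported along the `ℚ`-isomorphism by
`ordMinimalDiscriminant_smul_holds` / `hasAdditiveReductionAt_smul_iff_holds`) `W` is additive at
`v` with `ord_v Δ_min(W) = n + 6`, `n = ord_v Δ_min(Wd)` — Kodaira type `I_n^*` (not asserted).
[cite: SilvermanAEC2009, VII.1 Prop. 1.3(b) and VII.5 Prop. 5.1] -/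
theorem hasAdditiveReductionAt_and_ordMinimalDiscriminant_of_mult_twist
    (hv2 : (primesEquiv v : ℕ) ≠ 2) {d : ℤ} (h1 : ((primesEquiv v : ℕ) : ℤ) ∣ d)
    (h2 : ¬ ((primesEquiv v : ℕ) : ℤ) ^ 2 ∣ d) {Cd : VariableChange ℚ}
    (hCd : Cd • W.quadraticTwist (d : ℚ) = Wd) (hmult : Wd.HasMultiplicativeReductionAt v) :
    W.HasAdditiveReductionAt v ∧ W.ordMinimalDiscriminant v = Wd.ordMinimalDiscriminant v + 6 := by
  have hd0 : d ≠ 0 := by rintro rfl; exact h2 (dvd_zero _)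
  have hdq : (d : ℚ) ≠ 0 := by exact_mod_cast hd0
  haveI := Wd.isElliptic_quadraticTwist hdq
  obtain ⟨C, hC⟩ := exists_variableChange_smul_eq_of_smul_quadraticTwist_eq W Wd hdq hCd
  obtain ⟨-, hadd, hord⟩ := hasAdditiveReductionAt_quadraticTwist_of_dvd_of_mult Wd v hv2 h1 h2 hmult
  refine ⟨?_, ?_⟩
  · rw [hC]
    exact (hasAdditiveReductionAt_smul_iff_holds v (Wd.quadraticTwist (d : ℚ)) C).mpr hadd
  · rw [hC, ordMinimalDiscriminant_smul_holds v (Wd.quadraticTwist (d : ℚ)) C, hord]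

/-- **`ord_v(Cd.u) = 1` for the globally minimal twist `Wd = Cd • W^{(d)}` at a ramified prime of
multiplicative type.** With `n = ord_v Δ_min(Wd)`: `Δ(Wd) = Cd.u⁻¹² · d⁶ · Δ(W)` (Mathlib
`variableChange_Δ`, `quadraticTwist_Δ`), `ord_v Δ(W) = n + 6` (previous theorem; `W` globally
minimal), `ord_v Δ(Wd) = n`, `ord_v d = 1`, whence `12 · ord_v(Cd.u) = 12`. In the odd part of
Milne's identity this is the twist-side `δ`-term `δ_{d,p} = 1` at the potentially multiplicative
ramified prime (skeleton §1 (D)). [cite: SilvermanAEC2009, VII.1 Prop. 1.3(a) and Table 3.1] -/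
theorem valuation_u_eq_exp_neg_one_of_mult_twist
    (hv2 : (primesEquiv v : ℕ) ≠ 2) {d : ℤ} (h1 : ((primesEquiv v : ℕ) : ℤ) ∣ d)
    (h2 : ¬ ((primesEquiv v : ℕ) : ℤ) ^ 2 ∣ d) {Cd : VariableChange ℚ}
    (hCd : Cd • W.quadraticTwist (d : ℚ) = Wd) (hmult : Wd.HasMultiplicativeReductionAt v) :
    v.valuation ℚ (Cd.u : ℚ) = WithZero.exp (-1 : ℤ) := by
  have hd0 : d ≠ 0 := by rintro rfl; exact h2 (dvd_zero _)
  have hdq : (d : ℚ) ≠ 0 := by exact_mod_cast hd0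
  obtain ⟨-, hord⟩ :=
    hasAdditiveReductionAt_and_ordMinimalDiscriminant_of_mult_twist W Wd v hv2 h1 h2 hCd hmult
  have hΔW := valuation_Δ_eq_of_isMinimalAt_holds v W (IsGloballyMinimal.isMinimal v)
  have hΔWd := valuation_Δ_eq_of_isMinimalAt_holds v Wd (IsGloballyMinimal.isMinimal v)
  have hvD : v.valuation ℚ (d : ℚ) = WithZero.exp (-1 : ℤ) :=
    valuation_ringOfIntegers_intCast_eq_exp_neg_one v h1 h2
  -- `Δ(Wd) = u⁻¹² d⁶ Δ(W)`
  have hΔ : Wd.Δ = (↑Cd.u⁻¹ : ℚ) ^ 12 * ((d : ℚ) ^ 6 * W.Δ) := by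
    rw [← hCd, variableChange_Δ, quadraticTwist_Δ]
  have hu0 : v.valuation ℚ (Cd.u : ℚ) ≠ 0 :=
    (Valuation.ne_zero_iff _).mpr (Units.ne_zero _)
  obtain ⟨m, hm⟩ : ∃ m : ℤ, v.valuation ℚ (Cd.u : ℚ) = WithZero.exp m :=
    ⟨WithZero.log (v.valuation ℚ (Cd.u : ℚ)), (WithZero.exp_log hu0).symm⟩
  -- read valuations: `exp(-n) = exp(-m)^12 * (exp(-1)^6 * exp(-(n+6)))`
  have h := congrArg (v.valuation ℚ) hΔ
  rw [hΔWd, map_mul, map_mul, map_pow, map_pow, Units.val_inv_eq_inv_val, map_inv₀, hm, hvD, hΔW,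
    hord, ← WithZero.exp_neg, ← WithZero.exp_nsmul, ← WithZero.exp_nsmul, ← WithZero.exp_add,
    ← WithZero.exp_add, WithZero.exp_inj] at h
  rw [hm, WithZero.exp_inj]
  simp only [nsmul_eq_mul, Nat.cast_ofNat] at h
  push_cast at h
  omega

omit [W.IsGloballyMinimal] in
/-- **`v_p(c_v(W)) = 0` (`p ≥ 5`) at the potentially multiplicative ramified prime** — `W` is
additive there (previous theorems), `c ≤ 4`. [cite: SilvermanATAEC1994, Cor. IV.9.2(d) (PDF p. 340)] -/
theorem padicValNat_localTamagawaNumber_eq_zero_of_mult_twist_of_five_le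
    (hv2 : (primesEquiv v : ℕ) ≠ 2) {d : ℤ} (h1 : ((primesEquiv v : ℕ) : ℤ) ∣ d)
    (h2 : ¬ ((primesEquiv v : ℕ) : ℤ) ^ 2 ∣ d) {Cd : VariableChange ℚ}
    (hCd : Cd • W.quadraticTwist (d : ℚ) = Wd) (hmult : Wd.HasMultiplicativeReductionAt v)
    (p : ℕ) [Fact p.Prime] (h5 : 5 ≤ p) :
    padicValNat p ((W.baseChange (v.adicCompletion ℚ)).localTamagawaNumber
        (v.adicCompletionIntegers ℚ)) = 0 :=
  padicValNat_localTamagawaNumber_eq_zero_of_hasAdditiveReductionAt_of_five_le W v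
    (hasAdditiveReductionAt_and_ordMinimalDiscriminant_of_mult_twist W Wd v hv2 h1 h2 hCd hmult).1 p h5

end PotMult

end Summit.BirchSwinnertonDyer.Rank1Residual.AdditivePotMult

end
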